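import Summits.QuantumFields.YangMills.Theorems.UnitScaleTiltProp8ChartDressedCompetitorSet
import Summits.QuantumFields.YangMills.Theorems.UnitScaleTiltProp8HalvingSize152Flat
import Summits.QuantumFields.YangMills.Theorems.UnitScaleTiltProp8HalvingChartP1Display
import HarnessLib

/-!
# Route `UnitScaleTilt`, crux K1 «MinimiserStabilityRegPr» (stmt-QuantumFields-19200), stub V2′ `stub_halvingStep` — (K-E2E) door, C_E end, lemma L1 (LEAD ★w5-19200 g4 09:44:58Z):
# **THE CHART PREIMAGE `A′ = A + Hs(C♭ A)` OF THE P1♭ FIELD: self-adjoint, traceless, on the slice, with its (152) sizes** — inputs (tr)∕(ii)∕(iv) of ✓`row165_of_tracePairing_L5_su2`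
# from P1♭ (i)(iii)(iv), the `Hs` rows and the chart-of-record letters, every supplier by name

Cell `ym3-torus` (HUMAN RULING D-0037: rung R3, not Clay), width seat `ym-ust-19200-w8` g0∕s2.  `--supports stmt-QuantumFields-19200 --as helper`; def-free, 0 sorry.
NOT a claim about the stub, the crux, the rung or the gap.

References: T. Bałaban, CMP **102** (1985) [Balaban1985Variational] (45)–(47) p.285, (152)–(153) p.301, (157)–(158) p.302; CMP **99** (1985) [Balaban1985RegularSpaces] Thm 2, (1.36)–(1.38) p.82.
-/

set_option autoImplicit false

noncomputable section

open scoped BigOperators Matrix.Norms.L2Operator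

namespace Summit.QuantumFields.YangMills.Theorems.HalvingSitePackage

open Literature.MathematicalPhysics.QuantumFieldTheory.Balaban1983to89
open Literature.MathematicalPhysics.QuantumFieldTheory.Balaban1983to89.T3ContinuumYM3Torus
open B6SectADomainsV1 (Domains)
open B6SectAOperatorsV1 (BondIdx SiteIdx RE dsE)
open LatticeFieldCalculus (laplace diverg siteAvgIter)
open FlatCubeOpsText (Adm22 IsLevWeight)
open FlatOpsLettersAssembly (flatH)
open Prop8ChartDoubleBar (chartLogFlat chartLogFlat_star_weightedBall₀ fderiv_chartLogFlat_zero_star trace_chartRemainderFlat_eq_zero_weightedBall₀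
  isSelfAdjoint_apply_of_realKernel trace_apply_of_realKernel_eq_zero)

variable {F : T3Family} {n K : ℕ}

/-- **L1: THE CHART PREIMAGE OF THE P1♭ FIELD** — for `A` bondwise self-adjoint and traceless in the weighted ball of record with the P1♭ (152)♭ sizes and the (153)♭ multiplier slice, and
the level-scaled extension `Hs` (display spec + two rows): `A′ := A + Hs(C♭ A)` is bondwise self-adjoint (✓`chartLogFlat_star_weightedBall₀`), traceless
(✓`trace_chartRemainderFlat_eq_zero_weightedBall₀`), on the slice (✓`slice_of_chartPreimage_of_multiplier`), with (152) sizes `δ + B₀C₂♭δ²`, `δ′ + B₀C₂♭δ²` (✓`size152_flat`).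
[cite: Balaban1985Variational, (45)-(47) p.285, (152)-(153) p.301, (157) p.302] -/
theorem aPrime_rows (F : T3Family) (n K : ℕ) (D : Domains (F.P K)) (hDk : D.k = K - n) {R' M : ℕ} (hR'L : 2 * (F.P K).L ≤ R') (hM : 1 ≤ M)
    (hAdm : Adm22 D R' M)
    (hcollar : ∀ (i : ℕ) (e : PBond (F.P K) (i + 1)), D.LamBond (i + 1) e → ∀ z : Site (F.P K) i, (blockOf z = e.src ∨ blockOf z = e.tgt) → z ∈ D.Om i)
    {w : ℕ → PBond (F.P K) 0 → ℝ} (hw : IsLevWeight F n K D w)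
    (Hs : (BondIdx D → Matrix (Fin 2) (Fin 2) ℂ) →ₗ[ℂ] (PBond (F.P K) 0 → Matrix (Fin 2) (Fin 2) ℂ))
    (hHs : ∀ X b, Hs X b = ∑ c, (flatH F n K D (Pi.single c 1) b * ((F.L : ℝ) ^ (c.1.1 : ℕ) * ((F.L : ℝ)⁻¹) ^ (K - n))⁻¹) • X c) {B₀ : ℝ}
    (hHB : ∀ (X : BondIdx D → Matrix (Fin 2) (Fin 2) ℂ) (t : ℝ), (∀ c, ‖X c‖ ≤ t) → ∀ b, w 1 b * ‖Hs X b‖ ≤ B₀ * t)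
    (hHG : ∀ (X : BondIdx D → Matrix (Fin 2) (Fin 2) ℂ) (t : ℝ), (∀ c, ‖X c‖ ≤ t) → ∀ (b : PBond (F.P K) 0) (ν : Fin 3),
      w 2 b * (F.L : ℝ) ^ (K - n) * ‖Hs X ⟨b.src.shift ν, b.dir⟩ - Hs X b‖ ≤ B₀ * t)
    {A : PBond (F.P K) 0 → Matrix (Fin 2) (Fin 2) ℂ} (hAsa : ∀ b, IsSelfAdjoint (A b)) (hAtr : ∀ b, Matrix.trace (A b) = 0)
    (hslice : ∃ μ : SiteIdx D → Matrix (Fin 2) (Fin 2) ℂ, ∀ s : Site (F.P K) 0,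
      laplace ((F.L : ℝ) ^ (K - n)) (diverg ((F.L : ℝ) ^ (K - n)) A) s = ∑ i : SiteIdx D, siteAvgIter (i.1.1 : ℕ) (Pi.single s (1 : ℝ)) i.1.2 • μ i)
    {δ δ' R : ℝ} (hδ : δ < (16 * 3800 * ((((F.P K).d + 2) * (F.P K).L : ℕ) : ℝ) ^ 2 * (F.L : ℝ))⁻¹ / 4)
    (h1 : ∀ b, w 1 b * ‖A b‖ ≤ δ) (h2 : ∀ (b : PBond (F.P K) 0) (ν : Fin 3), w 2 b * (F.L : ℝ) ^ (K - n) * ‖A ⟨b.src.shift ν, b.dir⟩ - A b‖ ≤ δ')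
    (hR : 16 * 3800 * ((((F.P K).d + 2) * (F.P K).L : ℕ) : ℝ) ^ 2 * (F.L : ℝ) * R ≤ 1) (hAR : ∀ b, w 1 b * ‖A b‖ < R) :
    let C : (PBond (F.P K) 0 → Matrix (Fin 2) (Fin 2) ℂ) → BondIdx D → Matrix (Fin 2) (Fin 2) ℂ := fun Y i =>
      chartLogFlat (((F.L : ℝ)⁻¹) ^ (K - n)) D Y i -
        (fderiv ℂ (chartLogFlat (((F.L : ℝ)⁻¹) ^ (K - n)) D :
          (PBond (F.P K) 0 → Matrix (Fin 2) (Fin 2) ℂ) → BondIdx D → Matrix (Fin 2) (Fin 2) ℂ) 0) Y i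
    (∀ b, IsSelfAdjoint ((A + Hs (C A)) b)) ∧ (∀ b, Matrix.trace ((A + Hs (C A)) b) = 0) ∧
    (∀ φ : Matrix (Fin 2) (Fin 2) ℂ →ₗ[ℝ] ℝ,
      RE D ((F.L : ℝ) ^ (K - n)) (dsE ((F.L : ℝ) ^ (K - n)) (WithLp.toLp 2 (fun b => φ ((A + Hs (C A)) b)))) = 0) ∧
    (∀ b, w 1 b * ‖(A + Hs (C A)) b‖ ≤
        δ + B₀ * ((64 * (F.L : ℝ) / (16 * 3800 * ((((F.P K).d + 2) * (F.P K).L : ℕ) : ℝ) ^ 2 * (F.L : ℝ))⁻¹) * δ ^ 2)) ∧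
    (∀ (b : PBond (F.P K) 0) (ν : Fin 3),
        w 2 b * (F.L : ℝ) ^ (K - n) * ‖(A + Hs (C A)) ⟨b.src.shift ν, b.dir⟩ - (A + Hs (C A)) b‖ ≤
          δ' + B₀ * ((64 * (F.L : ℝ) / (16 * 3800 * ((((F.P K).d + 2) * (F.P K).L : ℕ) : ℝ) ^ 2 * (F.L : ℝ))⁻¹) * δ ^ 2)) := by
  intro C
  -- the real kernel of `Hs`
  set k : PBond (F.P K) 0 → BondIdx D → ℝ := fun b c => flatH F n K D (Pi.single c 1) b * ((F.L : ℝ) ^ (c.1.1 : ℕ) * ((F.L : ℝ)⁻¹) ^ (K - n))⁻¹ with hk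
  have hHs' : ∀ X b, Hs X b = ∑ c, k b c • X c := hHs
  -- the remainder at `A` is self-adjoint and traceless
  have hstarA : (fun b => star (A b)) = A := funext fun b => (hAsa b).star_eq
  have hCsa : ∀ c, IsSelfAdjoint (C A c) := fun c => by
    show star (C A c) = C A c
    show star (chartLogFlat (((F.L : ℝ)⁻¹) ^ (K - n)) D A c - _) = _
    rw [star_sub, ← chartLogFlat_star_weightedBall₀ F n K D hDk hcollar hw hR hAR c, ← fderiv_chartLogFlat_zero_star, hstarA]
  have hCtr : ∀ c, Matrix.trace (C A c) = 0 := fun c => trace_chartRemainderFlat_eq_zero_weightedBall₀ F n K D hDk hcollar hw hR hAR c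
  obtain ⟨hs1, hs2⟩ := HalvingSize152Flat.size152_flat F n K hR'L hM D hDk hAdm hw Hs hHB hHG A hδ h1 h2
  refine ⟨fun b => ?_, fun b => ?_, fun φ => ?_, hs1, hs2⟩
  · rw [Pi.add_apply]
    exact (hAsa b).add (isSelfAdjoint_apply_of_realKernel Hs k hHs' (C A) hCsa b)
  · rw [Pi.add_apply, Matrix.trace_add, hAtr b, trace_apply_of_realKernel_eq_zero Hs k hHs' (C A) hCtr b, add_zero]
  · -- the kernel-extension form of `Hs (C A)`
    have hHM : Hs (C A) = fun b => ∑ c, flatH F n K D (Pi.single c 1) b • ((((F.L : ℝ) ^ (c.1.1 : ℕ) * ((F.L : ℝ)⁻¹) ^ (K - n))⁻¹) • C A c) := by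
      funext b
      rw [hHs]
      exact Finset.sum_congr rfl fun c _ => by rw [mul_smul]
    rw [hHM]
    exact HalvingChartP1Display.slice_of_chartPreimage_of_multiplier D _ hslice φ

end Summit.QuantumFields.YangMills.Theorems.HalvingSitePackage

end
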